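import Mathlib
import HarnessLib
import Summits.NavierStokesRegularity.NavierStokesRegularity.Theorems.PoloidalWindowDoorPoloidalWindowRigiditySlopeFunctionPressure
import Summits.NavierStokesRegularity.NavierStokesRegularity.Theorems.PoloidalWindowDoorPoloidalWindowRigidityConstantShearSlice

/-!
# Route `PoloidalWindowDoor`, crux `PoloidalWindowRigidity` (K2, stmt-NavierStokesRegularity-19708) — the stratum (SF)
# «SHEAR SLOPE A FUNCTION OF TIME AND VERTICAL VELOCITY», II: the Clebsch weight is a PASSIVE SCALAR with height-only source

Cell ns-regularity-ideate, seat ns-poloidal-K2-p2 gen 4 (stub-worker on crux K2; file landed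
`--supports stmt-NavierStokesRegularity-19708` as a helper).  Sequel of `…SlopeFunctionPressure` (the stratum (SF):
`∂₂v_b = ∂_sG(t,v₂) ∂_b v₂`, `b = 0,1`, for one slope antiderivative `G : ℝ → ℝ → ℝ`; its pressure law
`slopeFunction_pressure`; the Clebsch weight `u = v₂ − G(t,v₂)` with `∇_h u = Jω_h` and
`𝓛u = (1 − ∂_sG)f₂ − ∂ₜG + ∂_s²G·Σᵢ(∂ᵢv₂)²`).  WHAT THIS IS NOT: not a claim about Navier–Stokes regularity, not the registered
stub `stub_lrcModEntire` — a structure theorem for one located stratum of the crux's generic residue (bears_on LADDER-NS N0 via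
crux K2 = stmt-19708).

* `hasDerivAt_slices_of_uncurry`, `deriv_deriv_comm` — calculus: slice derivatives of a jointly differentiable
  `G : ℝ → ℝ → ℝ` are values of `DG`, and Clairaut `∂_τ∂_sG = ∂_s∂_τG` for `G ∈ C²(ℝ²)` (`isSymmSndFDerivAt`).
* `differentiableAt_residual` — the intrinsic residual slice `f(t,·) = ∂ₜv + (v·∇)v − Δv` of a class profile is differentiable.
* `horizFDeriv_clebschSource_eq_zero` — **ON (SF) THE SOURCE OF THE CLEBSCH WEIGHT IS HORIZONTALLY CONSTANT**: for
  `G ∈ C³(ℝ²)`, `∂_b[(1 − ∂_sG(t,v₂)) f₂ − ∂ₜG(t,v₂) + ∂_s²G(t,v₂) Σᵢ(∂ᵢv₂)²] = 0` (`b = 0,1`) at every point of every slice —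
  the pressure law of part I with `m = ∂_sG`, Clairaut, and the symmetry of the second derivatives of `v₂`.  With part I's
  `material_clebschWeight`: **the Clebsch weight of an (SF) profile is a passive scalar, `𝓛u = a(t,x₂)`** ((TV): `u = (1−μ)v₂`,
  `a = (1−μ)f₂ − μ′v₂`, ns-poloidal-K2-p3 p517107).  Part III (`…SlopeFunctionPassive`) empties the sub-stratum `a = a(t)`;
  the height dependence of `a` is the located residual of (SF) (seat note SF-NEXT.md on the crux item).
-/


noncomputable section

-- the summit and its single sub-problem share the name (CONVENTIONS §1), as in every Theorems file
set_option linter.dupNamespace false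

namespace Summit.NavierStokesRegularity.NavierStokesRegularity.Theorems.PoloidalWindowDoorPoloidalWindowRigiditySlopeFunctionSource

open MeasureTheory Set Function Filter Topology TopologicalSpace Metric InnerProductSpace
open scoped RealInnerProductSpace InnerProductSpace Laplacian ContDiff
open Literature.Analysis Literature.Analysis.FluidPDE
open Summit.NavierStokesRegularity.NavierStokesRegularity.Theorems.LocalSineTubeDoorProfileAlignedWindowRigidityAncient
open Summit.NavierStokesRegularity.NavierStokesRegularity.Theorems.PoloidalWindowDoorPoloidalWindowRigidityWindow
open Summit.NavierStokesRegularity.NavierStokesRegularity.Theorems.PoloidalWindowDoorPoloidalWindowRigidityFlat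
open Summit.NavierStokesRegularity.NavierStokesRegularity.Theorems.PoloidalWindowDoorPoloidalWindowRigidityVelocityGradientLaw
open Summit.NavierStokesRegularity.NavierStokesRegularity.Theorems.PoloidalWindowDoorPoloidalWindowRigiditySeparatedPressure
open Summit.NavierStokesRegularity.NavierStokesRegularity.Theorems.PoloidalWindowDoorPoloidalWindowRigidityMaterialLeibniz
open Summit.NavierStokesRegularity.NavierStokesRegularity.Theorems.PoloidalWindowDoorPoloidalWindowRigidityVerticalSourceGauge
open Summit.NavierStokesRegularity.NavierStokesRegularity.Theorems.PoloidalWindowDoorPoloidalWindowRigidityConstantShearMeans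
open Summit.NavierStokesRegularity.NavierStokesRegularity.Theorems.PoloidalWindowDoorPoloidalWindowRigidityConstantShearSlice
open Summit.NavierStokesRegularity.NavierStokesRegularity.Theorems.PoloidalWindowDoorPoloidalWindowRigiditySlopeFunctionPressure

variable {C : ℝ} {v : ℝ → EuclideanSpace ℝ (Fin 3) → EuclideanSpace ℝ (Fin 3)}

/-! ### The source of the Clebsch weight is horizontally constant -/

/-- Partial derivatives of a jointly differentiable `G : ℝ → ℝ → ℝ` as values of its Fréchet derivative:
`∂_sG(τ,s) = DG(τ,s)(0,1)` and `∂_τG(τ,s) = DG(τ,s)(1,0)`. -/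
theorem hasDerivAt_slices_of_uncurry {G : ℝ → ℝ → ℝ} {p : ℝ × ℝ} (hG : DifferentiableAt ℝ (uncurry G) p) :
    HasDerivAt (G p.1) (fderiv ℝ (uncurry G) p (0, 1)) p.2 ∧
      HasDerivAt (fun τ => G τ p.2) (fderiv ℝ (uncurry G) p (1, 0)) p.1 := by
  rcases p with ⟨τ, s⟩
  have hW := hG.hasFDerivAt
  constructor
  · have h := (hW.comp s (hasFDerivAt_prodMk_right τ s)).hasDerivAt
    simp only [ContinuousLinearMap.comp_apply, ContinuousLinearMap.inr_apply] at h
    exact h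
  · have h := (hW.comp τ (hasFDerivAt_prodMk_left τ s)).hasDerivAt
    simp only [ContinuousLinearMap.comp_apply, ContinuousLinearMap.inl_apply] at h
    exact h

/-- **Clairaut for the slope antiderivative**: for `G ∈ C²(ℝ²)`, `∂_τ∂_sG = ∂_s∂_τG`, written with slice derivatives. -/
theorem deriv_deriv_comm {G : ℝ → ℝ → ℝ} (hG : ContDiff ℝ 2 (uncurry G)) (t s : ℝ) :
    deriv (fun τ => deriv (G τ) s) t = deriv (fun σ => deriv (fun τ => G τ σ) t) s := by
  have hd : ∀ p, DifferentiableAt ℝ (uncurry G) p := fun p => (hG.differentiable (by norm_num)) p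
  have e1 : (fun τ => deriv (G τ) s) = fun τ => fderiv ℝ (uncurry G) (τ, s) (0, 1) :=
    funext fun τ => (hasDerivAt_slices_of_uncurry (hd (τ, s))).1.deriv
  have e2 : (fun σ => deriv (fun τ => G τ σ) t) = fun σ => fderiv ℝ (uncurry G) (t, σ) (1, 0) :=
    funext fun σ => (hasDerivAt_slices_of_uncurry (hd (t, σ))).2.deriv
  have hD : DifferentiableAt ℝ (fderiv ℝ (uncurry G)) (t, s) :=
    ((hG.fderiv_right (m := 1) (by norm_num)).differentiable one_ne_zero) (t, s)
  -- the two mixed partials as values of the second Fréchet derivative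
  have h1 : HasDerivAt (fun τ => fderiv ℝ (uncurry G) (τ, s) (0, 1))
      (fderiv ℝ (fderiv ℝ (uncurry G)) (t, s) (1, 0) (0, 1)) t := by
    have ha : HasFDerivAt (fun p : ℝ × ℝ => fderiv ℝ (uncurry G) p (0, 1))
        ((fderiv ℝ (fderiv ℝ (uncurry G)) (t, s)).flip (0, 1)) (t, s) := by
      have h := hD.hasFDerivAt.clm_apply (hasFDerivAt_const ((0 : ℝ), (1 : ℝ)) (t, s))
      simpa using h
    have h := (ha.comp t (hasFDerivAt_prodMk_left t s)).hasDerivAt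
    simp only [ContinuousLinearMap.comp_apply, ContinuousLinearMap.inl_apply, ContinuousLinearMap.flip_apply] at h
    exact h
  have h2 : HasDerivAt (fun σ => fderiv ℝ (uncurry G) (t, σ) (1, 0))
      (fderiv ℝ (fderiv ℝ (uncurry G)) (t, s) (0, 1) (1, 0)) s := by
    have ha : HasFDerivAt (fun p : ℝ × ℝ => fderiv ℝ (uncurry G) p (1, 0))
        ((fderiv ℝ (fderiv ℝ (uncurry G)) (t, s)).flip (1, 0)) (t, s) := by
      have h := hD.hasFDerivAt.clm_apply (hasFDerivAt_const ((1 : ℝ), (0 : ℝ)) (t, s))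
      simpa using h
    have h := (ha.comp s (hasFDerivAt_prodMk_right t s)).hasDerivAt
    simp only [ContinuousLinearMap.comp_apply, ContinuousLinearMap.inr_apply, ContinuousLinearMap.flip_apply] at h
    exact h
  rw [e1, e2, h1.deriv, h2.deriv]
  exact (hG.contDiffAt.isSymmSndFDerivAt (by simp)) (1, 0) (0, 1)


section Class

variable (hrate : HasTypeITimeDecay C v) (hcont : ContinuousOn (uncurry v) (Iio (0 : ℝ) ×ˢ univ))
  (hmild : ∀ s t : ℝ, s < t → t < 0 → ∀ x,
    v t x = UnboundedOperators.heatExtension (v s) (t - s) x - oseenDuhamel 1 s v v t x)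
  (hdiv : ∀ t < 0, VectorCalculus.IsDivFree (v t))

include hrate hcont hmild hdiv

/-- The intrinsic residual slice `y ↦ f(t,y) = ∂ₜv + (v·∇)v − Δv` of a profile of the class is differentiable. -/
theorem differentiableAt_residual {t : ℝ} (ht : t < 0) (x : EuclideanSpace ℝ (Fin 3)) :
    DifferentiableAt ℝ (fun y => timeDerivWithin (Iio 0) v t y + convect (v t) (v t) y - Δ (v t) y) x := by
  have hA : IsTypeIAncientMild C v := isTypeIAncientMild_of_class hrate hcont hmild hdiv
  have hs : ContDiff ℝ ∞ (v t) := hA.contDiff_slice ht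
  have h1 : ContDiff ℝ ∞ (timeDerivWithin (Iio 0) v t) := by
    rw [timeDerivWithin_Iio_eq_deriv ht]; exact contDiff_timeDeriv_slice hrate hcont hmild hdiv ht
  have h2 : ContDiff ℝ ∞ (fun y => convect (v t) (v t) y) :=
    (hs.fderiv_right (m := ∞) (by norm_cast)).clm_apply hs
  have h3 : ContDiff ℝ 1 (Δ (v t)) := contDiff_laplacian (n := 1) (hs.of_le (by norm_cast))
  exact (((h1.differentiable (by simp)) x).add ((h2.differentiable (by simp)) x)).sub
    ((h3.differentiable (by simp)) x)

/-- **THE SOURCE OF THE CLEBSCH WEIGHT IS HORIZONTALLY CONSTANT.**  On the stratum (SF) with slope antiderivative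
`G ∈ C³(ℝ²)` (`∂₂v_b = ∂_sG(t,v₂)∂_bv₂`, `b = 0,1`), the material source of the Clebsch weight `u = v₂ − G(t,v₂)`,
`a := (1 − ∂_sG(t,v₂)) f₂ − ∂ₜG(t,v₂) + ∂_s²G(t,v₂) Σᵢ(∂ᵢv₂)²` (`= 𝓛u`, sequel `material_clebschWeight`), has vanishing
horizontal derivatives: `∂_b a = 0` for `b = 0,1` — the pressure law `slopeFunction_pressure` with `m = ∂_sG`, Clairaut
`∂ₜ∂_sG = ∂_s∂ₜG` and the symmetry of the second derivatives of `v₂`.  So `u` is a passive scalar driven by a source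
depending on time and height only. -/
theorem horizFDeriv_clebschSource_eq_zero
    (hpol : ∀ s < 0, ∀ y, ⟪curl (v s) y, EuclideanSpace.single 2 1⟫_ℝ = 0) {G : ℝ → ℝ → ℝ}
    (hG : ContDiff ℝ 3 (uncurry G)) {t : ℝ} (ht : t < 0)
    (hslope : ∀ s < 0, ∀ y, ∀ b : Fin 3, b ≠ 2 →
      fderiv ℝ (v s) y (EuclideanSpace.single 2 1) b =
        deriv (G s) (v s y 2) * fderiv ℝ (v s) y (EuclideanSpace.single b 1) 2)
    (x : EuclideanSpace ℝ (Fin 3)) {b : Fin 3} (hb : b ≠ 2) :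
    fderiv ℝ (fun y =>
        (1 - deriv (G t) (v t y 2)) * (timeDerivWithin (Iio 0) v t y + convect (v t) (v t) y - Δ (v t) y) 2
          - deriv (fun τ => G τ (v t y 2)) t
          + deriv (deriv (G t)) (v t y 2) * ∑ i : Fin 3, fderiv ℝ (v t) y (EuclideanSpace.single i 1) 2 ^ 2) x
      (EuclideanSpace.single b 1) = 0 := by
  have hA : IsTypeIAncientMild C v := isTypeIAncientMild_of_class hrate hcont hmild hdiv
  have hs : ContDiff ℝ ∞ (v t) := hA.contDiff_slice ht
  have hsd : Differentiable ℝ (v t) := hs.differentiable (by simp)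
  have hG2 : ContDiff ℝ 2 (uncurry G) := hG.of_le (by norm_cast)
  have hGd : ∀ p, DifferentiableAt ℝ (uncurry G) p := fun p => (hG2.differentiable (by norm_num)) p
  -- ## the slope function `m = ∂_sG` is jointly `C²`
  obtain ⟨m, hm⟩ : ∃ m : ℝ → ℝ → ℝ, ∀ τ σ, m τ σ = deriv (G τ) σ := ⟨_, fun _ _ => rfl⟩
  have hmfun : ∀ τ, m τ = deriv (G τ) := fun τ => funext (hm τ)
  have hm_unc : uncurry m = fun p => fderiv ℝ (uncurry G) p (0, 1) := by
    funext p; rcases p with ⟨τ, σ⟩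
    simp only [uncurry_apply_pair, hm]
    exact (hasDerivAt_slices_of_uncurry (hGd (τ, σ))).1.deriv
  have hm2 : ContDiff ℝ 2 (uncurry m) := by
    rw [hm_unc]; exact (hG.fderiv_right (m := 2) (by norm_cast)).clm_apply contDiff_const
  -- ## the pressure law with this slope function
  have hP := slopeFunction_pressure hrate hcont hmild hdiv hpol hm2 ht
    (fun s hs' y b' hb' => by rw [hm]; exact hslope s hs' y b' hb') x hb
  rw [hm, hmfun t] at hP
  have emt : (fun τ => m τ (v t x 2)) = fun τ => deriv (G τ) (v t x 2) := funext fun τ => hm τ _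
  rw [emt] at hP
  -- ## regularity of the pieces at `x`
  have hθ : ContDiff ℝ ∞ (fun y => v t y 2) := contDiff_vert_slice hrate hcont hmild hdiv ht
  have hθd : DifferentiableAt ℝ (fun y => v t y 2) x := (hθ.differentiable (by simp)) x
  have hGt3 : ContDiff ℝ 3 (G t) := hG.comp (contDiff_const.prodMk contDiff_id)
  have hG'2 : ContDiff ℝ 2 (deriv (G t)) := (contDiff_succ_iff_deriv.1 (hGt3 : ContDiff ℝ ((2 : ℕ∞) + 1 : ℕ∞) (G t))).2.2
  have hG''1 : ContDiff ℝ 1 (deriv (deriv (G t))) :=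
    (contDiff_succ_iff_deriv.1 (hG'2 : ContDiff ℝ ((1 : ℕ∞) + 1 : ℕ∞) (deriv (G t)))).2.2
  have hR := differentiableAt_residual hrate hcont hmild hdiv ht x
  have hF2 : DifferentiableAt ℝ
      (fun y => (timeDerivWithin (Iio 0) v t y + convect (v t) (v t) y - Δ (v t) y) 2) x :=
    ((EuclideanSpace.proj (𝕜 := ℝ) (2 : Fin 3) : EuclideanSpace ℝ (Fin 3) →L[ℝ] ℝ).differentiableAt).comp x hR
  have hEnt : ∀ i : Fin 3, ContDiff ℝ ∞ (fun y => fderiv ℝ (v t) y (EuclideanSpace.single i 1) 2) := fun i =>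
    contDiff_fderiv_coord hrate hcont hmild hdiv ht (EuclideanSpace.single i 1) 2
  have hEntd : ∀ i : Fin 3, DifferentiableAt ℝ (fun y => fderiv ℝ (v t) y (EuclideanSpace.single i 1) 2) x :=
    fun i => ((hEnt i).differentiable (by simp)) x
  have hQd : DifferentiableAt ℝ (fun y => ∑ i : Fin 3, fderiv ℝ (v t) y (EuclideanSpace.single i 1) 2 ^ 2) x := by
    refine DifferentiableAt.fun_sum fun i _ => (hEntd i).pow 2
  -- `∂_sG(t, v₂(·))`, `∂_s²G(t, v₂(·))` and `∂ₜG(t, v₂(·))` along the slice, with their derivatives at `x`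
  have hA1 : HasFDerivAt (fun y => deriv (G t) (v t y 2))
      (deriv (deriv (G t)) (v t x 2) • fderiv ℝ (fun y => v t y 2) x) x :=
    ((hG'2.differentiable (by norm_num)) _).hasDerivAt.comp_hasFDerivAt x hθd.hasFDerivAt
  have hA2 : HasFDerivAt (fun y => deriv (deriv (G t)) (v t y 2))
      (deriv (deriv (deriv (G t))) (v t x 2) • fderiv ℝ (fun y => v t y 2) x) x :=
    ((hG''1.differentiable (by norm_num)) _).hasDerivAt.comp_hasFDerivAt x hθd.hasFDerivAt
  -- the time partial `∂ₜG(t,·)` as a `C²` function of `s`, and Clairaut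
  obtain ⟨Gt, hGt⟩ : ∃ Gt : ℝ → ℝ, ∀ σ, Gt σ = deriv (fun τ => G τ σ) t := ⟨_, fun _ => rfl⟩
  have hGt_eq : Gt = fun σ => fderiv ℝ (uncurry G) (t, σ) (1, 0) :=
    funext fun σ => by rw [hGt]; exact (hasDerivAt_slices_of_uncurry (hGd (t, σ))).2.deriv
  have hGt2 : ContDiff ℝ 2 Gt := by
    rw [hGt_eq]
    exact ((hG.fderiv_right (m := 2) (by norm_cast)).clm_apply contDiff_const).comp
      (contDiff_const.prodMk contDiff_id)
  have hB : HasFDerivAt (fun y => deriv (fun τ => G τ (v t y 2)) t)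
      (deriv Gt (v t x 2) • fderiv ℝ (fun y => v t y 2) x) x := by
    have e : (fun y => deriv (fun τ => G τ (v t y 2)) t) = fun y => Gt (v t y 2) := funext fun y => (hGt _).symm
    rw [e]
    exact ((hGt2.differentiable (by norm_num)) _).hasDerivAt.comp_hasFDerivAt x hθd.hasFDerivAt
  have hClairaut : deriv Gt (v t x 2) = deriv (fun τ => deriv (G τ) (v t x 2)) t := by
    have e : Gt = fun σ => deriv (fun τ => G τ σ) t := funext hGt
    rw [e, deriv_deriv_comm hG2]
  -- ## differentiate the source
  have hT : ∀ w, fderiv ℝ (fun y => v t y 2) x w = fderiv ℝ (v t) x w 2 := fun w =>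
    FluidPDE.fderiv_apply_coord (hsd x) w 2
  have hsq : ∀ i : Fin 3, HasFDerivAt (fun y => fderiv ℝ (v t) y (EuclideanSpace.single i 1) 2 ^ 2)
      ((2 * fderiv ℝ (v t) x (EuclideanSpace.single i 1) 2) •
        fderiv ℝ (fun y => fderiv ℝ (v t) y (EuclideanSpace.single i 1) 2) x) x := by
    intro i
    have h := (hEntd i).hasFDerivAt
    have h2 := h.mul h
    have e1 : (fun y => fderiv ℝ (v t) y (EuclideanSpace.single i 1) 2 ^ 2) =
        fun y => fderiv ℝ (v t) y (EuclideanSpace.single i 1) 2 * fderiv ℝ (v t) y (EuclideanSpace.single i 1) 2 :=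
      funext fun y => sq _
    rw [e1, two_mul, add_smul]
    exact h2
  have hQ : HasFDerivAt (fun y => ∑ i : Fin 3, fderiv ℝ (v t) y (EuclideanSpace.single i 1) 2 ^ 2)
      (∑ i : Fin 3, (2 * fderiv ℝ (v t) x (EuclideanSpace.single i 1) 2) •
        fderiv ℝ (fun y => fderiv ℝ (v t) y (EuclideanSpace.single i 1) 2) x) x :=
    HasFDerivAt.fun_sum fun i _ => hsq i
  have hdQ : fderiv ℝ (fun y => ∑ i : Fin 3, fderiv ℝ (v t) y (EuclideanSpace.single i 1) 2 ^ 2) x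
      (EuclideanSpace.single b 1) =
      ∑ i : Fin 3, 2 * fderiv ℝ (v t) x (EuclideanSpace.single i 1) 2 *
        fderiv ℝ (fun y => fderiv ℝ (v t) y (EuclideanSpace.single b 1) 2) x (EuclideanSpace.single i 1) := by
    rw [hQ.fderiv, FunLike.coe_sum, Finset.sum_apply]
    refine Finset.sum_congr rfl fun i _ => ?_
    simp only [FunLike.coe_smul, Pi.smul_apply, smul_eq_mul]
    -- symmetry of the second derivatives of `v₂`
    have hsym : fderiv ℝ (fun y => fderiv ℝ (v t) y (EuclideanSpace.single i 1) 2) x (EuclideanSpace.single b 1) =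
        fderiv ℝ (fun y => fderiv ℝ (v t) y (EuclideanSpace.single b 1) 2) x (EuclideanSpace.single i 1) := by
      have e : ∀ c : EuclideanSpace ℝ (Fin 3), (fun y => fderiv ℝ (v t) y c 2) = fun y => fderiv ℝ (fun z => v t z 2) y c :=
        fun c => funext fun y => (FluidPDE.fderiv_apply_coord (hsd y) c 2).symm
      rw [e, e]
      exact fderiv_fderiv_symm (hθ.of_le (by norm_cast)) x _ _
    rw [hsym]
  have hdA : fderiv ℝ (fun y => (1 - deriv (G t) (v t y 2)) *
        (timeDerivWithin (Iio 0) v t y + convect (v t) (v t) y - Δ (v t) y) 2) x (EuclideanSpace.single b 1) =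
      -(deriv (deriv (G t)) (v t x 2) * fderiv ℝ (v t) x (EuclideanSpace.single b 1) 2) *
          (timeDerivWithin (Iio 0) v t x + convect (v t) (v t) x - Δ (v t) x) 2 +
        (1 - deriv (G t) (v t x 2)) *
          fderiv ℝ (fun y => timeDerivWithin (Iio 0) v t y + convect (v t) (v t) y - Δ (v t) y) x
            (EuclideanSpace.single b 1) 2 := by
    have h1 : DifferentiableAt ℝ (fun y => 1 - deriv (G t) (v t y 2)) x := hA1.differentiableAt.const_sub 1
    rw [fderiv_fun_mul h1 hF2]
    simp only [_root_.add_apply, FunLike.coe_smul, Pi.smul_apply, smul_eq_mul]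
    rw [fderiv_const_sub, hA1.fderiv, ← FluidPDE.fderiv_apply_coord hR]
    simp only [neg_apply, FunLike.coe_smul, Pi.smul_apply, smul_eq_mul, hT]
    ring
  have hdB : fderiv ℝ (fun y => deriv (fun τ => G τ (v t y 2)) t) x (EuclideanSpace.single b 1) =
      deriv (fun τ => deriv (G τ) (v t x 2)) t * fderiv ℝ (v t) x (EuclideanSpace.single b 1) 2 := by
    rw [hB.fderiv, ← hClairaut]
    simp only [FunLike.coe_smul, Pi.smul_apply, smul_eq_mul, hT]
  have hdC : fderiv ℝ (fun y => deriv (deriv (G t)) (v t y 2) *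
        ∑ i : Fin 3, fderiv ℝ (v t) y (EuclideanSpace.single i 1) 2 ^ 2) x (EuclideanSpace.single b 1) =
      deriv (deriv (deriv (G t))) (v t x 2) * fderiv ℝ (v t) x (EuclideanSpace.single b 1) 2 *
          ∑ i : Fin 3, fderiv ℝ (v t) x (EuclideanSpace.single i 1) 2 ^ 2 +
        deriv (deriv (G t)) (v t x 2) *
          ∑ i : Fin 3, 2 * fderiv ℝ (v t) x (EuclideanSpace.single i 1) 2 *
            fderiv ℝ (fun y => fderiv ℝ (v t) y (EuclideanSpace.single b 1) 2) x (EuclideanSpace.single i 1) := by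
    rw [fderiv_fun_mul hA2.differentiableAt hQd]
    simp only [_root_.add_apply, FunLike.coe_smul, Pi.smul_apply, smul_eq_mul]
    rw [hdQ, hA2.fderiv]
    simp only [FunLike.coe_smul, Pi.smul_apply, smul_eq_mul, hT]
    ring
  -- ## assemble
  have hdAd : DifferentiableAt ℝ (fun y => (1 - deriv (G t) (v t y 2)) *
        (timeDerivWithin (Iio 0) v t y + convect (v t) (v t) y - Δ (v t) y) 2) x :=
    (hA1.differentiableAt.const_sub 1).mul hF2
  have hdAB : DifferentiableAt ℝ (fun y => (1 - deriv (G t) (v t y 2)) *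
        (timeDerivWithin (Iio 0) v t y + convect (v t) (v t) y - Δ (v t) y) 2
        - deriv (fun τ => G τ (v t y 2)) t) x := hdAd.sub hB.differentiableAt
  have hdCd : DifferentiableAt ℝ (fun y => deriv (deriv (G t)) (v t y 2) *
        ∑ i : Fin 3, fderiv ℝ (v t) y (EuclideanSpace.single i 1) 2 ^ 2) x := hA2.differentiableAt.mul hQd
  rw [fderiv_fun_add hdAB hdCd, fderiv_fun_sub hdAd hB.differentiableAt]
  simp only [_root_.add_apply, _root_.sub_apply]
  rw [hdA, hdB, hdC, Finset.mul_sum]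
  simp only [Fin.sum_univ_three] at hP ⊢
  linear_combination hP

end Class

end Summit.NavierStokesRegularity.NavierStokesRegularity.Theorems.PoloidalWindowDoorPoloidalWindowRigiditySlopeFunctionSource

end
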